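import Summits.Parity.GeneralizedHardyLittlewood.Theorems.FordMaynardSieveConst01651SieveConst01651SignClauseFive
import Summits.Parity.GeneralizedHardyLittlewood.Theorems.FordMaynardSieveConst01651SieveConst01651SignClauseFaces
import HarnessLib

/-!
# Route `FordMaynardSieveConst01651`, target `SieveConst01651` (stmt-Parity-19185), stub `stub_coneCertClosed`,
# residue `h5`: only GENERIC points of `ℋ₅` need checking, and only through the ten couples

Def-free helper file.  Combining the face-penalty device (`…SignClauseFaces`) with the couple reduction
(`…SignClauseFive`) for the explicit witness `coneCert`:

* `gTab_le_one` — the table part is `≤ 1` on every subvector (so `2⁵ · 1 ≤ 64 = M`);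
* `coneCert_starSum_nonpos_of_edge` / `_of_bandline` — a point of `ℋ₅` with a coordinate on a grid edge, or with a pair sum on
  a band line (`c₀` or `1/2`), has `(𝟙⋆coneCert)(x) ≤ 0` for free (its singleton / pair subvector carries `gFace ≤ −64`);
* `coneCert_signClause_five_of_generic` — **`h5` ⟸ the couple inequality at generic points only**:
  `∀ x` monotone, `|x| = 1`, `ν₀ < xᵢ < 1 − ν₀`, all `xᵢ ∈ openSmall`, no pair sum in `{c₀, 1/2}` ⟹
  `−4 + ∑_{|A|=2} (coneCert₂(x_A) + coneCert₃(x_{Aᶜ})) ≤ 0`;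
* `stub_coneCertClosed_of_generic_five` — the registered stub signature ⟸ that generic couple inequality ∧ `hV`.

Each couple at a generic point is one table lookup (`…CoupleEval.couple_eval_generic`); the empty types come with exact
Farkas certificates (item evidence).  This is the final shape of residue `h5`.

References: [FordMaynard2024PrimeSieves] arXiv:2407.14368, Theorem 7.3 (a), §8.2.
-/

noncomputable section

open Finset
open scoped Classical
open Literature.NumberTheory.Sieve Literature.NumberTheory.Sieve.FordMaynard

namespace Summit.Parity.GeneralizedHardyLittlewood.FordMaynardSieveConst01651SieveConst01651

/-- The table part never exceeds `1`. [folklore] -/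
theorem gTab_le_one (r : ℕ) (y : Fin r → ℝ) : gTab r y ≤ 1 := by
  match r with
  | 0 => exact le_of_eq rfl
  | 1 =>
      show (if _ then _ else _ : ℝ) ≤ 1
      split_ifs <;> norm_num
  | 2 => exact (gTab_two_le y).trans (by norm_num)
  | 3 => exact (gTab_three_le y).trans (by norm_num)
  | n + 4 => exact le_of_eq_of_le (rfl : gTab (n + 4) y = 0) zero_le_one

/-- On the closed support region, one pair sum on a band line already gives `gFace ≤ −64`. [folklore] -/
theorem gFace_le_of_bandline {r : ℕ} {y : Fin r → ℝ} (hr : 1 ≤ r) (hr3 : r ≤ 3) (hy : Monotone y)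
    (hbox : ∀ i, (1651 / 10000 : ℝ) < y i) (hsum : ∑ i, y i ≤ 1 / 2)
    (hline : ∃ i j, i < j ∧ (y i + y j = 8349 / 20000 ∨ y i + y j = 1 / 2)) :
    gFace r y ≤ -64 := by
  unfold gFace
  rw [if_pos ⟨hr, hr3, hy, hbox, hsum⟩]
  obtain ⟨i, j, hij, hl⟩ := hline
  have h1 : 1 ≤ faceCount r y := by
    unfold faceCount
    rcases hl with hl | hl
    · have : 1 ≤ (Finset.univ.filter (fun q : Fin r × Fin r => q.1 < q.2 ∧ y q.1 + y q.2 = 8349 / 20000)).card :=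
        Finset.card_pos.2 ⟨(i, j), Finset.mem_filter.2 ⟨Finset.mem_univ _, hij, hl⟩⟩
      omega
    · have : 1 ≤ (Finset.univ.filter (fun q : Fin r × Fin r => q.1 < q.2 ∧ y q.1 + y q.2 = 1 / 2)).card :=
        Finset.card_pos.2 ⟨(i, j), Finset.mem_filter.2 ⟨Finset.mem_univ _, hij, hl⟩⟩
      omega
  have h1' : (1 : ℝ) ≤ (faceCount r y : ℝ) := by exact_mod_cast h1
  nlinarith

/-- A point of `ℋ₅` with a coordinate on a grid edge is signed for free. [cite: FordMaynard2024PrimeSieves, Definition 7.2] -/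
theorem coneCert_starSum_nonpos_of_edge (x : Fin 5 → ℝ) (hbox : ∀ i, (1651 / 10000 : ℝ) < x i)
    (hsum : ∑ i, x i = 1) {i : Fin 5} (hi : x i ∈ edgeSet) : starSum coneCert 5 x ≤ 0 := by
  have hlt : ∀ l, x l < 1 - 4 * (1651 / 10000 : ℝ) := apply_lt_of_five hbox hsum
  show starSum (fun r y => gTab r y + gFace r y) 5 x ≤ 0
  refine starSum_nonpos_of_face gTab gFace x (B := 1) (M := 64) (fun A => gTab_le_one _ _)
    (fun A => gFace_nonpos _ _) {i} ?_ (by norm_num)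
  have hc : ({i} : Finset (Fin 5)).card = 1 := Finset.card_singleton i
  rw [← apply_orderEmb_cast' gFace x {i} hc]
  refine gFace_le_of_edge le_rfl (by norm_num) (Subsingleton.monotone _) (fun t => hbox _) ?_ ⟨0, ?_⟩
  · rw [Fin.sum_univ_one]; linarith [hlt (({i} : Finset (Fin 5)).orderEmbOfFin hc 0)]
  · rw [Finset.orderEmbOfFin_singleton]; exact hi

/-- A point of `ℋ₅` with a pair sum on a band line (`c₀` or `1/2`) is signed for free.
[cite: FordMaynard2024PrimeSieves, Definition 7.2] -/
theorem coneCert_starSum_nonpos_of_bandline (x : Fin 5 → ℝ) (hx : Monotone x) (hbox : ∀ i, (1651 / 10000 : ℝ) < x i)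
    {i j : Fin 5} (hij : i < j) (hl : x i + x j = 8349 / 20000 ∨ x i + x j = 1 / 2) :
    starSum coneCert 5 x ≤ 0 := by
  show starSum (fun r y => gTab r y + gFace r y) 5 x ≤ 0
  have hne : i ≠ j := hij.ne
  have hc : ({i, j} : Finset (Fin 5)).card = 2 := Finset.card_pair hne
  refine starSum_nonpos_of_face gTab gFace x (B := 1) (M := 64) (fun A => gTab_le_one _ _)
    (fun A => gFace_nonpos _ _) {i, j} ?_ (by norm_num)
  rw [← apply_orderEmb_cast' gFace x {i, j} hc]
  set e := ({i, j} : Finset (Fin 5)).orderEmbOfFin hc with he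
  have hs : x (e 0) + x (e 1) = x i + x j := by
    have h := sum_orderEmb_eq x {i, j} hc
    rw [Fin.sum_univ_two, Finset.sum_pair hne] at h
    exact h
  refine gFace_le_of_bandline (by norm_num) (by norm_num) (hx.comp e.monotone) (fun t => hbox _) ?_
    ⟨0, 1, by decide, ?_⟩
  · rw [Fin.sum_univ_two]
    show x (e 0) + x (e 1) ≤ 1 / 2
    rw [hs]
    rcases hl with h | h
    · rw [h]; norm_num
    · exact h.le
  · show x (e 0) + x (e 1) = 8349 / 20000 ∨ x (e 0) + x (e 1) = 1 / 2
    rw [hs]; exact hl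

/-- **Residue `h5` ⟸ the couple inequality at GENERIC points.** [cite: FordMaynard2024PrimeSieves, Theorem 7.3 (a), §8.2] -/
theorem coneCert_signClause_five_of_generic
    (hgen : ∀ x : Fin 5 → ℝ, Monotone x → (∀ i, (1651 / 10000 : ℝ) < x i ∧ x i < 1 - 1651 / 10000) →
      ∑ i, x i = 1 → (∀ i, x i ∈ openSmall) →
      (∀ i j, i < j → x i + x j ≠ 8349 / 20000 ∧ x i + x j ≠ 1 / 2) →
      -4 + ∑ A ∈ (Finset.univ : Finset (Finset (Fin 5))).filter (fun A => A.card = 2),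
        (coneCert A.card (fun i => x (A.orderEmbOfFin rfl i)) +
          coneCert Aᶜ.card (fun i => x (Aᶜ.orderEmbOfFin rfl i))) ≤ 0) :
    ∀ x : Fin 5 → ℝ, Monotone x → (∀ i, (1651 / 10000 : ℝ) < x i ∧ x i < 1 - 1651 / 10000) →
      ∑ i, x i = 1 → starSum coneCert 5 x ≤ 0 := by
  intro x hx hbox hsum
  have hbox' : ∀ i, (1651 / 10000 : ℝ) < x i := fun i => (hbox i).1
  have hlt : ∀ i, x i < 1 - 4 * (1651 / 10000 : ℝ) := apply_lt_of_five hbox' hsum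
  by_cases hopen : ∀ i, x i ∈ openSmall
  · by_cases hpair : ∀ i j, i < j → x i + x j ≠ 8349 / 20000 ∧ x i + x j ≠ 1 / 2
    · exact (coneCert_five_le_couples x hx hbox' hsum).trans (hgen x hx hbox hsum hopen hpair)
    · push Not at hpair
      obtain ⟨i, j, hij, hl⟩ := hpair
      have hl' : x i + x j = 8349 / 20000 ∨ x i + x j = 1 / 2 := by
        by_cases h : x i + x j = 8349 / 20000
        · exact Or.inl h
        · exact Or.inr (hl h)
      exact coneCert_starSum_nonpos_of_bandline x hx hbox' hij hl'
  · push Not at hopen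
    obtain ⟨i, hi⟩ := hopen
    have hedge : x i ∈ edgeSet := by
      by_contra h
      exact hi ⟨hbox' i, by linarith [hlt i], h⟩
    exact coneCert_starSum_nonpos_of_edge x hbox' hsum hedge

/-- **`stub_coneCertClosed` from the generic dimension-5 couple inequality and the certificate value.**
The registered signature, verbatim. [cite: FordMaynard2024PrimeSieves, Theorem 7.3 (a), §8.2] -/
theorem stub_coneCertClosed_of_generic_five
    (hgen : ∀ x : Fin 5 → ℝ, Monotone x → (∀ i, (1651 / 10000 : ℝ) < x i ∧ x i < 1 - 1651 / 10000) →
      ∑ i, x i = 1 → (∀ i, x i ∈ openSmall) →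
      (∀ i j, i < j → x i + x j ≠ 8349 / 20000 ∧ x i + x j ≠ 1 / 2) →
      -4 + ∑ A ∈ (Finset.univ : Finset (Finset (Fin 5))).filter (fun A => A.card = 2),
        (coneCert A.card (fun i => x (A.orderEmbOfFin rfl i)) +
          coneCert Aᶜ.card (fun i => x (Aᶜ.orderEmbOfFin rfl i))) ≤ 0)
    (hV : 0 < sieveBoundG1 (1651 / 10000) coneCert) :
    ∃ g₀ : VecFn, IsPiecewiseConstOnCone g₀ ∧ (∀ e : Fin 0 → ℝ, g₀ 0 e = 1) ∧
      (∀ (k : ℕ) (x : Fin k → ℝ), Monotone x → g₀ k x ≠ 0 →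
        k = 0 ∨ ((∀ i, (1651 / 10000 : ℝ) < x i) ∧ ∑ i, x i ≤ 1 / 2)) ∧
      (∀ k : ℕ, 2 ≤ k → k ≤ 6 → ∀ x : Fin k → ℝ, Monotone x →
        (∀ i, (1651 / 10000 : ℝ) < x i ∧ x i < 1 - 1651 / 10000) → ∑ i, x i = 1 → starSum g₀ k x ≤ 0) ∧
      0 < sieveBoundG1 (1651 / 10000) g₀ :=
  stub_coneCertClosed_of_residues' (coneCert_signClause_five_of_generic hgen) hV

end Summit.Parity.GeneralizedHardyLittlewood.FordMaynardSieveConst01651SieveConst01651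

end
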